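import Literature.AlgebraicGeometry.HodgeTheory.MotivatedClassesTransport
import Literature.AlgebraicGeometry.HodgeTheory.GysinKernelProofs
import Literature.AlgebraicGeometry.HodgeTheory.TopDegreeClasses
import Literature.AlgebraicTopology.SingularHomology.GysinMapOrientationChange
import HarnessLib

/-!
# `pr_{X*}(A_mot(X × Z)) ⊆ A_mot(X)`: André 1996, Prop. 2.1 (ii), second inclusion, on the real carriers

Family `hodge`, layer `Literature/AlgebraicGeometry/HodgeTheory`. Companion (theorems only) of
`MotivatedClasses.lean` (André's motivated classes `A_motᵖ(X)_ℂ = motivatedClasses n X p ⊆ H²ᵖ(X(ℂ); ℂ)`,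
the span of the generators `pr_{X*}(α ∪ *_L β)` of Y. André, *Pour une théorie inconditionnelle des
motifs*, Publ. Math. IHÉS 83 (1996), §2.1 Déf. 1), which lists Prop. 2.1 among the theorems NOT there.

Source, verbatim (Prop. 2.1 (ii), p. 14): "On a : `pr^{XZ*}_X A_mot(X)_E ⊆ (A_mot(X × Z)_E)` et
`pr^{XZ}_{X*}(A_mot(X × Z)_E) ⊆ (A_mot(X)_E)`", and its proof for the SECOND inclusion (p. 15): "On a,
d'autre part, `pr^{XZ}_{X*} pr^{XZY}_{XZ*}(α ∪ *β) = pr^{X(ZY)}_{X*}(α ∪ *β)`." — a generator of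
`A_mot(X × Z)` with auxiliary variety `Y` pushes forward to the generator of `A_mot(X)` with auxiliary
variety `Z × Y` (functoriality of push-forwards and `(X × Z) × Y = X × (Z × Y)`). Only this inclusion is
proved here; the first one and Prop. 2.1 (i) rest on Lemme 1.3.2 (the Lefschetz involution of a product
polarisation), which the real carriers do not have.

On the real carriers (`IsMotivatedClass`: topological Gysin maps `gysinMap μ ν pr_X(ℂ)` of
`ℂ`-orientations with Poincaré duality, any polarisation class of `X ⊗ Y`) the printed line becomes:

* `gysinMap_comap_symm_eq_map_symm` — for a homeomorphism `h : X ≃ₜ Y` of a closed oriented manifold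
  onto `Y` carrying the transported orientation `μ.comap h⁻¹`, `h_! = (h⁻¹)^*` (Fulton App. B (5)–(7)
  with `deg h = 1`; Hatcher Thm. 3.26);
* the orientation `ν` of `(X ⊗ Z)(ℂ)` hidden in a generator of `A_mot(X ⊗ Z)` and the orientation `ν₁`
  used for `pr_{X*}` differ by a unit `u` (`(X ⊗ Z)(ℂ)` is connected:
  `HomologicalOrientation.exists_unit_fundamentalClass_eq_smul`, Hatcher Thm. 3.26 (b)), under which
  the Gysin map rescales by `u⁻¹` (`gysinMap_eq_smul_of_fundamentalClass_eq`) — harmless in the span;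
* `pr^{XZ}_{X!} ∘ pr^{(XZ)Y}_{XZ!} = (pr_X ∘ a)_! = pr^{X(ZY)}_{X!} ∘ a_! = pr^{X(ZY)}_{X!} ∘ (a⁻¹)^*` for
  the associator `a : (X ⊗ Z) ⊗ Y ≅ X ⊗ (Z ⊗ Y)` (`gysinMap_comp`, Fulton App. B (5), and the first
  bullet), and `(a⁻¹)^*(α ∪ *_L β) = (a⁻¹)^*α ∪ *_{L'} (a⁻¹)^*β` with the transported polarisation
  (`cupProduct_map`, `lefschetzInvolution_map`, `IsPolarizationClass.map_of_iso`,
  `mem_algebraicClasses_map_of_iso` of `MotivatedClassesTransport`);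
* `gysinMap_fst_mem_motivatedClasses` — **`pr_{X*}(A_mot^{p+l}(X ⊗ Z)_ℂ) ⊆ A_motᵖ(X)_ℂ`** for `X`, `Z`
  smooth projective of dimensions `n`, `l` and ANY `ℂ`-orientations of `(X ⊗ Z)(ℂ)`, `X(ℂ)` with
  Poincaré duality; `complexGysin_fst_mem_motivatedClasses` — the same for the Gysin morphism
  `complexGysin μ` of an orientation family (`HodgeTheory/ComplexGysin`).
* `gysinMap_snd_mem_motivatedClasses`, `complexGysin_snd_mem_motivatedClasses` — the same for the
  projection onto the second factor (through the swap `X ⊗ Z ≅ Z ⊗ X` and the transport of motivated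
  classes along isomorphisms, `map_mem_motivatedClasses_of_iso` of `MotivatedClassesTransport`).

## References

* [Andre1996Motifs] Y. André, Pour une théorie inconditionnelle des motifs, Publ. Math. IHÉS 83
  (1996) 5–49: Prop. 2.1 (ii) (p. 14) and its proof (p. 15), §2.1 Déf. 1 (p. 14).
* [FultonYoungTableaux1997] W. Fulton, Young Tableaux, CUP 1997, App. B §B.1 (2), (5)–(7).
* [HatcherAT2002] A. Hatcher, Algebraic Topology, CUP 2002, §3.3 Thm. 3.26, Lemma 3.27, Thm. 3.30.
-/

noncomputable section

open CategoryTheory AlgebraicGeometry MonoidalCategory CartesianMonoidalCategory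
open Literature.AlgebraicTopology.SingularHomology Literature.Geometry.Kaehler

universe u v

/-! ### Topology: the Gysin map of a homeomorphism is the pull-back along its inverse -/

namespace Literature.AlgebraicTopology.SingularHomology

section Homeomorph

variable {R : Type v} [CommRing R]
variable {X Y : Type u} [TopologicalSpace X] [TopologicalSpace Y] {n : ℕ}

/-- **`h_! = (h⁻¹)^*`** for a homeomorphism `h : X ≃ₜ Y` of a closed `R`-oriented manifold `X` (orientation
`μ` with Poincaré duality) onto `Y` carrying the transported orientation `μ.comap h⁻¹`: `h` has degree `1`
(`[Y]_{μ.comap h⁻¹} = h_* [X]_μ`, `HomologicalOrientation.fundamentalClass_comap_of_compactSpace`, Hatcher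
Thm. 3.26), so `h_! (h^* y) = y` (the tree's `gysinMap_map_of_hasDegree`, Fulton App. B (6)–(7)) and every
`x` is `h^* ((h⁻¹)^* x)`. [cite: FultonYoungTableaux1997, Appendix B §B.1 (5)–(7)]
[cite: HatcherAT2002, §3.3 Thm. 3.26 (a) and Lemma 3.27] -/
theorem gysinMap_comap_symm_eq_map_symm [CompactSpace X] [T2Space X]
    [ChartedSpace (EuclideanSpace ℝ (Fin n)) X] {μ : HomologicalOrientation R X n}
    (hμ : μ.HasPoincareDuality) (h : X ≃ₜ Y) {p q : ℕ} (hpq : p + q = n)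
    (x : singularCohomology R R X p) :
    gysinMap μ (μ.comap h.symm) (h : C(X, Y)) hpq hpq x =
      singularCohomology.map R R (h.symm : C(Y, X)) p x := by
  have hdeg : HasDegree μ (μ.comap h.symm) (h : C(X, Y)) 1 := by
    rw [HasDegree, HomologicalOrientation.fundamentalClass_comap_of_compactSpace μ h.symm,
      Homeomorph.symm_symm, one_zsmul]
  conv_lhs => rw [← singularCohomology.map_map_symm h p x]
  rw [gysinMap_map_of_hasDegree (hμ.comap h.symm) hdeg hpq, one_zsmul]

end Homeomorph

end Literature.AlgebraicTopology.SingularHomology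

/-! ### Prop. 2.1 (ii), second inclusion -/

namespace Literature.AlgebraicGeometry.HodgeTheory

section HodgeTheory

variable {n l : ℕ} {X Z : Motives.SchemeOver ℂ}

/-- **`pr_{X*}(A_mot(X × Z)) ⊆ A_mot(X)`** (André 1996, Prop. 2.1 (ii), second inclusion: "On a, d'autre
part, `pr^{XZ}_{X*} pr^{XZY}_{XZ*}(α ∪ *β) = pr^{X(ZY)}_{X*}(α ∪ *β)`", p. 15), on the real carriers: for
`X`, `Z` smooth projective over `ℂ` of dimensions `n`, `l`, `ℂ`-orientations `ν₁` of `(X ⊗ Z)(ℂ)` and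
`ν_X` of `X(ℂ)` satisfying Poincaré duality, and `x ∈ A_mot^{p+l}(X ⊗ Z)_ℂ`, the Gysin image
`pr_{X*} x = gysinMap ν₁ ν_X pr_X(ℂ) x ∈ H²ᵖ(X(ℂ); ℂ)` lies in `A_motᵖ(X)_ℂ`. For a generator
`x = pr^{(XZ)Y}_{XZ*}(α ∪ *_L β)` (auxiliary `Y`, orientations `μ`, `ν`): `ν = u • ν₁` for a unit `u`
(`(X ⊗ Z)(ℂ)` is connected), so `pr_{X*} x = u⁻¹ • (pr_X ∘ pr_{XZ})_!(α ∪ *_L β)` (`gysinMap_comp`), and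
`pr_X ∘ pr_{XZ} = pr_X ∘ a` for the associator `a : (X ⊗ Z) ⊗ Y ≅ X ⊗ (Z ⊗ Y)`, whence
`(pr_X ∘ pr_{XZ})_! = pr^{X(ZY)}_{X!} ∘ (a⁻¹)^*` for the transported orientation
(`gysinMap_comap_symm_eq_map_symm`) and `(a⁻¹)^*(α ∪ *_L β) = (a⁻¹)^*α ∪ *_{L'} (a⁻¹)^*β` is of generator
shape with auxiliary variety `Z ⊗ Y` (`isMotivatedClass_gysinMap`). [cite: Andre1996Motifs, Prop. 2.1 (ii) (p. 14) and proof (p. 15)]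
[cite: FultonYoungTableaux1997, Appendix B §B.1 (2) and (5)] [cite: HatcherAT2002, §3.3 Thm. 3.26 (b)] -/
theorem gysinMap_fst_mem_motivatedClasses (hX : Motives.IsSmoothProjective n X)
    (hZ : Motives.IsSmoothProjective l Z)
    (ν₁ : HomologicalOrientation ℂ (Motives.ComplexPoints (X ⊗ Z)) (2 * (n + l)))
    (νX : HomologicalOrientation ℂ (Motives.ComplexPoints X) (2 * n))
    (hν₁ : ν₁.HasPoincareDuality) (hνX : νX.HasPoincareDuality) {p q : ℕ}
    (H₁ : 2 * (p + l) + 2 * q = 2 * (n + l)) (H₂ : 2 * p + 2 * q = 2 * n)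
    {x : complexBetti (X ⊗ Z) (2 * (p + l))} (hx : x ∈ motivatedClasses (n + l) (X ⊗ Z) (p + l)) :
    gysinMap ν₁ νX (Motives.AlgPoints.mapContinuous (L := ℂ) (fst X Z)) H₁ H₂ x ∈
      motivatedClasses n X p := by
  classical
  have hXZ : Motives.IsSmoothProjective (n + l) (X ⊗ Z) := Motives.IsSmoothProjective.tensor_holds hX hZ
  suffices h : motivatedClasses (n + l) (X ⊗ Z) (p + l) ≤ (motivatedClasses n X p).comap
      (gysinMap ν₁ νX (Motives.AlgPoints.mapContinuous (L := ℂ) (fst X Z)) H₁ H₂) from h hx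
  rw [motivatedClasses_le_iff]
  rintro y ⟨m, Y, hY, μ, ν, hμ, hν, η, hη, a, b, b', q₀, hbb', hab, hq, α, β, hα, hβ, rfl⟩
  obtain rfl : q = q₀ := by omega
  rw [Submodule.mem_comap]
  have hW : Motives.IsSmoothProjective (n + l + m) ((X ⊗ Z) ⊗ Y) :=
    Motives.IsSmoothProjective.tensor_holds hXZ hY
  have hZY : Motives.IsSmoothProjective (l + m) (Z ⊗ Y) := Motives.IsSmoothProjective.tensor_holds hZ hY
  have hB : Motives.IsSmoothProjective (n + (l + m)) (X ⊗ (Z ⊗ Y)) :=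
    Motives.IsSmoothProjective.tensor_holds hX hZY
  letI := hXZ.chartedSpace
  haveI := Motives.ComplexPoints.compactSpace_of_isSmoothProjective hXZ
  haveI := Motives.ComplexPoints.t2Space_of_isSmoothProjective hXZ
  haveI : ConnectedSpace (Motives.ComplexPoints (X ⊗ Z)) := connectedSpace_complexPoints hXZ
  letI := hW.chartedSpace
  haveI := Motives.ComplexPoints.compactSpace_of_isSmoothProjective hW
  haveI := Motives.ComplexPoints.t2Space_of_isSmoothProjective hW
  -- (1) the two orientations of `(X ⊗ Z)(ℂ)` differ by a unit `u`: `[ν] = u • [ν₁]`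
  obtain ⟨u, hu, -⟩ := ν₁.exists_unit_fundamentalClass_eq_smul ν
  have h₁ : 2 * (p + l + m) + 2 * q = 2 * (n + l + m) := by omega
  have hchange : gysinMap μ ν (Motives.AlgPoints.mapContinuous (L := ℂ) (fst (X ⊗ Z) Y)) h₁ H₁ =
      ((u⁻¹ : ℂˣ) : ℂ) • gysinMap μ ν₁ (Motives.AlgPoints.mapContinuous (L := ℂ) (fst (X ⊗ Z) Y)) h₁ H₁ :=
    gysinMap_eq_smul_of_fundamentalClass_eq hν₁ hν (one_smul ℂ μ.fundamentalClass).symm hu u.mul_inv _ h₁ H₁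
  rw [hchange, LinearMap.smul_apply, map_smul]
  refine Submodule.smul_mem _ _ ?_
  -- (2) `pr^{XZ}_{X!} ∘ pr^{(XZ)Y}_{XZ!} = (pr_{XZ} ≫ pr_X)_! = (α ≫ pr_X)_!`
  rw [← LinearMap.comp_apply (f := gysinMap ν₁ νX _ H₁ H₂), ← gysinMap_comp hν₁,
    ← Motives.AlgPoints.mapContinuous_comp, ← associator_hom_fst, Motives.AlgPoints.mapContinuous_comp,
    ← Motives.AlgPoints.coe_homeomorphOfIso_eq_mapContinuous]
  set aH := Motives.AlgPoints.homeomorphOfIso (L := ℂ) (α_ X Z Y) with haH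
  -- (3) `(α ≫ pr_X)_! = pr_{X!} ∘ α_! = pr_{X!} ∘ (α⁻¹)^*` for the orientation transported along `α⁻¹`
  have hμa : (μ.comap aH.symm).HasPoincareDuality := hμ.comap aH.symm
  rw [gysinMap_comp (μZ := μ) (μX := νX) hμa
      (aH : C(Motives.ComplexPoints ((X ⊗ Z) ⊗ Y), Motives.ComplexPoints (X ⊗ (Z ⊗ Y))))
      (Motives.AlgPoints.mapContinuous (L := ℂ) (fst X (Z ⊗ Y))) h₁ h₁ H₂,
    LinearMap.comp_apply, gysinMap_comap_symm_eq_map_symm hμ aH h₁]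
  -- (4) transport `α`, `β`, `η` and `*_L` along `α⁻¹ : X ⊗ (Z ⊗ Y) ≅ (X ⊗ Z) ⊗ Y`
  have hmap : ∀ i, complexBetti.map (α_ X Z Y).inv i =
      singularCohomology.map ℂ ℂ (aH.symm : C(Motives.ComplexPoints (X ⊗ (Z ⊗ Y)),
        Motives.ComplexPoints ((X ⊗ Z) ⊗ Y))) i := fun i ↦ rfl
  have hηa : IsPolarizationClass (n + l + m) (X ⊗ (Z ⊗ Y)) (complexBetti.map (α_ X Z Y).inv 2 η) :=
    hη.map_of_iso hW hB (α_ X Z Y).symm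
  have hαa : complexBetti.map (α_ X Z Y).inv (2 * a) α ∈ algebraicClasses (X ⊗ (Z ⊗ Y)) a :=
    mem_algebraicClasses_map_of_iso hW hB (α_ X Z Y).symm hα
  have hβa : complexBetti.map (α_ X Z Y).inv (2 * b) β ∈ algebraicClasses (X ⊗ (Z ⊗ Y)) b :=
    mem_algebraicClasses_map_of_iso hW hB (α_ X Z Y).symm hβ
  have h₃ : 2 * a + 2 * b' = 2 * (p + l + m) := by omega
  have h₄ : 2 * b + 2 * b' = 2 * (n + l + m) := by omega
  have key : singularCohomology.map ℂ ℂ (aH.symm : C(Motives.ComplexPoints (X ⊗ (Z ⊗ Y)),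
        Motives.ComplexPoints ((X ⊗ Z) ⊗ Y))) (2 * (p + l + m))
        (cupProduct h₃ α (lefschetzInvolution hη.hasHardLefschetz h₄ β)) =
      cupProduct h₃ (complexBetti.map (α_ X Z Y).inv (2 * a) α)
        (lefschetzInvolution hηa.hasHardLefschetz h₄ (complexBetti.map (α_ X Z Y).inv (2 * b) β)) := by
    rw [cupProduct_map, ← hmap, ← hmap,
      lefschetzInvolution_map (α_ X Z Y).inv hη.hasHardLefschetz hηa.hasHardLefschetz]
  rw [key]
  -- (5) re-index `(n + l) + m = n + (l + m)` and recognise the generator with auxiliary variety `Z ⊗ Y`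
  have hηb : IsPolarizationClass (n + (l + m)) (X ⊗ (Z ⊗ Y)) (complexBetti.map (α_ X Z Y).inv 2 η) := by
    rw [show n + (l + m) = n + l + m by omega]
    exact hηa
  obtain ⟨μ', hμ', hEQ⟩ : ∃ μ' : HomologicalOrientation ℂ (Motives.ComplexPoints (X ⊗ (Z ⊗ Y)))
      (2 * (n + (l + m))), μ'.HasPoincareDuality ∧
      gysinMap μ' νX (Motives.AlgPoints.mapContinuous (L := ℂ) (fst X (Z ⊗ Y)))
          (show 2 * (p + (l + m)) + 2 * q = 2 * (n + (l + m)) by omega) H₂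
          (cupProduct (show 2 * a + 2 * b' = 2 * (p + (l + m)) by omega)
            (complexBetti.map (α_ X Z Y).inv (2 * a) α)
            (lefschetzInvolution hηb.hasHardLefschetz (show 2 * b + 2 * b' = 2 * (n + (l + m)) by omega)
              (complexBetti.map (α_ X Z Y).inv (2 * b) β))) =
        gysinMap (μ.comap aH.symm) νX (Motives.AlgPoints.mapContinuous (L := ℂ) (fst X (Z ⊗ Y))) h₁ H₂
          (cupProduct h₃ (complexBetti.map (α_ X Z Y).inv (2 * a) α)
            (lefschetzInvolution hηa.hasHardLefschetz h₄ (complexBetti.map (α_ X Z Y).inv (2 * b) β))) := by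
    have gen : ∀ (D P : ℕ) (_ : n + l + m = D) (_ : p + l + m = P)
        (hL : HasHardLefschetzProperty (complexBetti.map (α_ X Z Y).inv 2 η) D)
        (e₁ : 2 * P + 2 * q = 2 * D) (e₃ : 2 * a + 2 * b' = 2 * P) (e₄ : 2 * b + 2 * b' = 2 * D),
        ∃ μ' : HomologicalOrientation ℂ (Motives.ComplexPoints (X ⊗ (Z ⊗ Y))) (2 * D),
          μ'.HasPoincareDuality ∧
          gysinMap μ' νX (Motives.AlgPoints.mapContinuous (L := ℂ) (fst X (Z ⊗ Y))) e₁ H₂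
              (cupProduct e₃ (complexBetti.map (α_ X Z Y).inv (2 * a) α)
                (lefschetzInvolution hL e₄ (complexBetti.map (α_ X Z Y).inv (2 * b) β))) =
            gysinMap (μ.comap aH.symm) νX (Motives.AlgPoints.mapContinuous (L := ℂ) (fst X (Z ⊗ Y))) h₁ H₂
              (cupProduct h₃ (complexBetti.map (α_ X Z Y).inv (2 * a) α)
                (lefschetzInvolution hηa.hasHardLefschetz h₄
                  (complexBetti.map (α_ X Z Y).inv (2 * b) β))) := by
      rintro D P rfl rfl hL e₁ e₃ e₄
      exact ⟨μ.comap aH.symm, hμa, rfl⟩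
    exact gen _ _ (by omega) (by omega) hηb.hasHardLefschetz _ _ _
  rw [← hEQ]
  exact (isMotivatedClass_gysinMap (n := n) (X := X) (p := p) hZY μ' νX hμ' hνX hηb (a := a) (b := b)
    (b' := b') (q := q) (by omega) (by omega) (by omega) hαa hβa).mem_motivatedClasses

/-- **`pr_{X*}(A_mot(X × Z)) ⊆ A_mot(X)` for the Gysin morphism of an orientation family** (André 1996,
Prop. 2.1 (ii), second inclusion), with `pr_{X*} = complexGysin μ pr_X : H^{2(p+l)}((X ⊗ Z)(ℂ)) →
H²ᵖ(X(ℂ))` the Gysin morphism of `HodgeTheory/ComplexGysin` relative to any orientation family `μ`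
(Poincaré duality holds unconditionally, `OrientationFamily.hasPoincareDuality`): for
`x ∈ A_mot^{p+l}(X ⊗ Z)_ℂ`, `pr_{X*} x ∈ A_motᵖ(X)_ℂ` (`gysinMap_fst_mem_motivatedClasses`; for `p > n`
the target `H²ᵖ(X(ℂ); ℂ)` is `0`). [cite: Andre1996Motifs, Prop. 2.1 (ii) (p. 14) and proof (p. 15)]
[cite: FultonYoungTableaux1997, Appendix B §B.1 (5)] -/
theorem complexGysin_fst_mem_motivatedClasses (μ : OrientationFamily) (hX : Motives.IsSmoothProjective n X)
    (hZ : Motives.IsSmoothProjective l Z) (hXZ : Motives.IsSmoothProjective (n + l) (X ⊗ Z)) {p : ℕ}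
    (hab : 2 * (p + l) + 2 * n = 2 * p + 2 * (n + l)) {x : complexBetti (X ⊗ Z) (2 * (p + l))}
    (hx : x ∈ motivatedClasses (n + l) (X ⊗ Z) (p + l)) :
    complexGysin μ hXZ hX (fst X Z) hab x ∈ motivatedClasses n X p := by
  by_cases hp : p ≤ n
  · rw [complexGysin_eq_gysinMap hXZ hX (fst X Z) hab (q := 2 * (n - p)) (by omega) (by omega)]
    exact gysinMap_fst_mem_motivatedClasses hX hZ (μ hXZ) (μ hX) (μ.hasPoincareDuality hXZ)
      (μ.hasPoincareDuality hX) _ _ hx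
  · haveI := subsingleton_complexBetti hX (show 2 * n < 2 * p by omega)
    rw [Subsingleton.elim (complexGysin μ hXZ hX (fst X Z) hab x) 0]
    exact Submodule.zero_mem _

/-- **`pr_{Z*}(A_mot(X × Z)) ⊆ A_mot(Z)`** — Prop. 2.1 (ii), second inclusion, for the projection onto
the SECOND factor (André's statement with the roles of the factors exchanged; `X × Z ≅ Z × X`): for
`X`, `Z` smooth projective of dimensions `n`, `l`, `ℂ`-orientations `ν₁` of `(X ⊗ Z)(ℂ)` and `ν_Z` of
`Z(ℂ)` with Poincaré duality and `x ∈ A_mot^{p+n}(X ⊗ Z)_ℂ`, `pr_{Z*} x ∈ A_motᵖ(Z)_ℂ`. Proof: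
`pr_Z = pr_Z^{ZX} ∘ σ` for the swap `σ : X ⊗ Z ≅ Z ⊗ X`, `pr_{Z!} = pr^{ZX}_{Z!} ∘ σ_! = pr^{ZX}_{Z!} ∘ (σ⁻¹)^*`
for the transported orientation (`gysinMap_comp`, `gysinMap_comap_symm_eq_map_symm`), `(σ⁻¹)^* x ∈
A_mot(Z ⊗ X)` (`map_mem_motivatedClasses_of_iso`), and `gysinMap_fst_mem_motivatedClasses`.
[cite: Andre1996Motifs, Prop. 2.1 (ii) (p. 14) and proof (p. 15)] [cite: FultonYoungTableaux1997, Appendix B §B.1 (2) and (5)] -/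
theorem gysinMap_snd_mem_motivatedClasses (hX : Motives.IsSmoothProjective n X)
    (hZ : Motives.IsSmoothProjective l Z)
    (ν₁ : HomologicalOrientation ℂ (Motives.ComplexPoints (X ⊗ Z)) (2 * (n + l)))
    (νZ : HomologicalOrientation ℂ (Motives.ComplexPoints Z) (2 * l))
    (hν₁ : ν₁.HasPoincareDuality) (hνZ : νZ.HasPoincareDuality) {p q : ℕ}
    (H₁ : 2 * (p + n) + 2 * q = 2 * (n + l)) (H₂ : 2 * p + 2 * q = 2 * l)
    {x : complexBetti (X ⊗ Z) (2 * (p + n))} (hx : x ∈ motivatedClasses (n + l) (X ⊗ Z) (p + n)) :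
    gysinMap ν₁ νZ (Motives.AlgPoints.mapContinuous (L := ℂ) (snd X Z)) H₁ H₂ x ∈
      motivatedClasses l Z p := by
  classical
  have hXZ : Motives.IsSmoothProjective (n + l) (X ⊗ Z) := Motives.IsSmoothProjective.tensor_holds hX hZ
  have hZX : Motives.IsSmoothProjective (n + l) (Z ⊗ X) := by
    rw [Nat.add_comm]
    exact Motives.IsSmoothProjective.tensor_holds hZ hX
  letI := hXZ.chartedSpace
  haveI := Motives.ComplexPoints.compactSpace_of_isSmoothProjective hXZ
  haveI := Motives.ComplexPoints.t2Space_of_isSmoothProjective hXZ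
  -- the swap `σ : X ⊗ Z ≅ Z ⊗ X`, `σ ≫ pr_Z^{ZX} = pr_Z^{XZ}`
  obtain ⟨σ, hσ⟩ : ∃ σ : X ⊗ Z ≅ Z ⊗ X, σ.hom ≫ fst Z X = snd X Z :=
    ⟨⟨lift (snd X Z) (fst X Z), lift (snd Z X) (fst Z X),
      CartesianMonoidalCategory.hom_ext _ _ (by simp) (by simp),
      CartesianMonoidalCategory.hom_ext _ _ (by simp) (by simp)⟩, lift_fst _ _⟩
  rw [← hσ, Motives.AlgPoints.mapContinuous_comp, ← Motives.AlgPoints.coe_homeomorphOfIso_eq_mapContinuous]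
  set sH := Motives.AlgPoints.homeomorphOfIso (L := ℂ) σ with hsH
  -- `pr_{Z!} = pr^{ZX}_{Z!} ∘ σ_! = pr^{ZX}_{Z!} ∘ (σ⁻¹)^*`
  have hμs : (ν₁.comap sH.symm).HasPoincareDuality := hν₁.comap sH.symm
  rw [gysinMap_comp (μZ := ν₁) (μX := νZ) hμs
      (sH : C(Motives.ComplexPoints (X ⊗ Z), Motives.ComplexPoints (Z ⊗ X)))
      (Motives.AlgPoints.mapContinuous (L := ℂ) (fst Z X)) H₁ H₁ H₂,
    LinearMap.comp_apply, gysinMap_comap_symm_eq_map_symm hν₁ sH H₁]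
  -- `(σ⁻¹)^* x ∈ A_mot(Z ⊗ X)`
  have hx' : singularCohomology.map ℂ ℂ (sH.symm : C(Motives.ComplexPoints (Z ⊗ X),
      Motives.ComplexPoints (X ⊗ Z))) (2 * (p + n)) x ∈ motivatedClasses (n + l) (Z ⊗ X) (p + n) :=
    map_mem_motivatedClasses_of_iso hXZ hZX σ.symm hx
  -- re-index `n + l = l + n` (orientation and span) and conclude by the first-factor case
  have gen : ∀ (D : ℕ) (_ : n + l = D),
      ∃ μ' : HomologicalOrientation ℂ (Motives.ComplexPoints (Z ⊗ X)) (2 * D), μ'.HasPoincareDuality ∧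
        ∀ e₁ : 2 * (p + n) + 2 * q = 2 * D,
          gysinMap μ' νZ (Motives.AlgPoints.mapContinuous (L := ℂ) (fst Z X)) e₁ H₂ =
            gysinMap (ν₁.comap sH.symm) νZ (Motives.AlgPoints.mapContinuous (L := ℂ) (fst Z X)) H₁ H₂ := by
    rintro D rfl
    exact ⟨_, hμs, fun _ ↦ rfl⟩
  obtain ⟨μ', hμ', hEQ⟩ := gen (l + n) (Nat.add_comm n l)
  rw [← hEQ (by omega)]
  rw [Nat.add_comm n l] at hx'
  exact gysinMap_fst_mem_motivatedClasses hZ hX μ' νZ hμ' hνZ _ H₂ hx'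

/-- **`pr_{Z*}(A_mot(X × Z)) ⊆ A_mot(Z)` for the Gysin morphism of an orientation family** (Prop. 2.1 (ii),
second inclusion, second factor), `pr_{Z*} = complexGysin μ pr_Z : H^{2(p+n)}((X ⊗ Z)(ℂ)) → H²ᵖ(Z(ℂ))`.
[cite: Andre1996Motifs, Prop. 2.1 (ii) (p. 14) and proof (p. 15)] [cite: FultonYoungTableaux1997, Appendix B §B.1 (5)] -/
theorem complexGysin_snd_mem_motivatedClasses (μ : OrientationFamily) (hX : Motives.IsSmoothProjective n X)
    (hZ : Motives.IsSmoothProjective l Z) (hXZ : Motives.IsSmoothProjective (n + l) (X ⊗ Z)) {p : ℕ}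
    (hab : 2 * (p + n) + 2 * l = 2 * p + 2 * (n + l)) {x : complexBetti (X ⊗ Z) (2 * (p + n))}
    (hx : x ∈ motivatedClasses (n + l) (X ⊗ Z) (p + n)) :
    complexGysin μ hXZ hZ (snd X Z) hab x ∈ motivatedClasses l Z p := by
  by_cases hp : p ≤ l
  · rw [complexGysin_eq_gysinMap hXZ hZ (snd X Z) hab (q := 2 * (l - p)) (by omega) (by omega)]
    exact gysinMap_snd_mem_motivatedClasses hX hZ (μ hXZ) (μ hZ) (μ.hasPoincareDuality hXZ)
      (μ.hasPoincareDuality hZ) _ _ hx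
  · haveI := subsingleton_complexBetti hZ (show 2 * l < 2 * p by omega)
    rw [Subsingleton.elim (complexGysin μ hXZ hZ (snd X Z) hab x) 0]
    exact Submodule.zero_mem _

end HodgeTheory

end Literature.AlgebraicGeometry.HodgeTheory

end
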